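import Summits.PneNP.PneNP.Theses.UncheckableSAT

/-!
# Line `counting-split` for the crux `Thesis` (stmt-PneNP-2298), route PneNP/UncheckableSAT

Crux-strategist DECOMPOSITION of X := `Thesis` ("UNSAT has no interactive proof whose honest prover is in
FP^SAT") into STRUCTURE × HARDNESS:

  X ⇐ ProversMustCount ∧ BPPNPCannotCountMod            (assembly = modus ponens at K := SAT)

* `ProversMustCount` (PMC): for every language K, an interactive proof for UNSAT (the Thesis' own template)
  with honest prover in FP^K forces Mod_mP ⊆ BPP^K for some modulus m ≥ 2 — "provers of unsatisfiability must
  count (modulo something)". Stubs S1–S3 below prove it: S2 (prover-efficient Goldwasser–Sipser) makes the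
  verifier public-coin at no cost in extractability, S1 (public-coin universal extraction — the OPEN heart)
  extracts Mod_m-counting from ANY complete prover of a sound public-coin verifier, S3 composes oracles.
* `BPPNPCannotCountMod` (NMC): Mod_mP ⊄ BPP^NP for every m ≥ 2 — "approximate counting (BPP^NP: Stockmeyer,
  Jerrum–Valiant–Vazirani) cannot count exactly, not even mod m". Stubs T1 (BPP^NP ⊆ PH, Lautemann/Sipser–Gács
  relativised — known) and T2 (Mod_mP ⊄ PH for every m ≥ 2 — OPEN; the uniform shadow of Razborov–Smolensky's
  MOD_m ∉ AC⁰, which IS its relativised form; implied by "PH infinite" via Toda–Ogiwara, and NOT known to imply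
  P ≠ NP) prove it.

Mod_mP (Beigel–Gill 1992, Hertrampf 1990) is written inline: `ModClass m`; m = 2 is the tree's `ParityP` up to
`Odd n ↔ ¬ 2 ∣ n`.
-/

set_option linter.dupNamespace false

namespace Summit.PneNP.PneNP.Cruxes.Thesis.CountingSplit

open Literature.Computability.Complexity
open Summit.PneNP.PneNP.Theses.UncheckableSAT

/-- `Mod_mP`: `x ∈ L ↔ m ∤ #{y ∈ {0,1}^{p|x|} | ⟨x,y⟩ ∈ R}` for some `R ∈ P`, polynomial `p`.
[Beigel–Gill 1992, Def. 2.1; Arora–Barak 2009, Def. 17.15 (m = 2)] -/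
abbrev ModClass (m : ℕ) : Set (Language Bool) :=
  {L : Language Bool | ∃ R ∈ Literature.Computability.Complexity.Classes.P, ∃ p : Polynomial ℕ,
    ∀ x : List Bool, x ∈ L ↔ ¬ (m ∣ Literature.Computability.Complexity.countWitnesses R (p.eval x.length) x)}

/-- The honest run of `V` against the uniform prover strategy `msgs ↦ M⟨x, enc msgs⟩` (Thesis' template). -/
noncomputable abbrev honestProb (V : IPVerifier) (c : ℕ) (M : List Bool → List Bool) (x : List Bool) : ℝ :=
  V.acceptProb (x.length ^ c) x (fun msgs => M (boolPair x ((Computability.encodingList Bool).listBool.encode msgs)))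

/-- Completeness `2/3` on `UNSAT` with the honest prover `M` (Thesis' template). -/
abbrev Complete (V : IPVerifier) (c : ℕ) (M : List Bool → List Bool) : Prop :=
  ∀ x ∈ UNSAT, (2 / 3 : ℝ) ≤ honestProb V c M x

/-- Soundness `1/3` off `UNSAT` against ALL provers (Thesis' template). -/
abbrev Sound (V : IPVerifier) (c : ℕ) : Prop :=
  ∀ x ∉ UNSAT, ∀ P : IPProver, V.acceptProb (x.length ^ c) x P ≤ 1 / 3

/-- Public-coin (Arthur–Merlin) verifier in the tree's extensional model: the verifier's `i`-th message is the
`i`-th block of its coin string (the verdict may read everything). [Babai–Moran 1988 §1; Goldwasser–Sipser 1986] -/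
abbrev IsPublicCoin (V : IPVerifier) : Prop :=
  ∀ (x r : List Bool) (msgs : List (List Bool)),
    V.next (IPVerifier.view x r msgs) = (r.drop (V.msgLen.eval x.length * (msgs.length / 2))).take (V.msgLen.eval x.length)

/-! ## The two pieces (local copies of the filed statements) -/

/-- Piece 1 of the split (STRUCTURE) — verbatim the statement filed for the route decl `ProversMustCount`
(local copy until `route edit --split` writes it into the route file). -/
def ProversMustCount : Prop :=
  ∀ (V : Literature.Computability.Complexity.IPVerifier) (c : ℕ) (M : List Bool → List Bool) (K : Language Bool), V.IsPolyTime → M ∈ Literature.Computability.Complexity.FPRel (Literature.Computability.Complexity.Oracle.ofLanguage K) → (∀ x ∈ Literature.Computability.Complexity.UNSAT, (2 / 3 : ℝ) ≤ V.acceptProb (x.length ^ c) x (fun msgs => M (Literature.Computability.Complexity.boolPair x ((Computability.encodingList Bool).listBool.encode msgs)))) → (∀ x ∉ Literature.Computability.Complexity.UNSAT, ∀ P : Literature.Computability.Complexity.IPProver, V.acceptProb (x.length ^ c) x P ≤ 1 / 3) → ∃ m : ℕ, 2 ≤ m ∧ {L : Language Bool | ∃ R ∈ Literature.Computability.Complexity.Classes.P,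 ∃ p : Polynomial ℕ, ∀ x : List Bool, x ∈ L ↔ ¬ (m ∣ Literature.Computability.Complexity.countWitnesses R (p.eval x.length) x)} ⊆ Literature.Computability.Complexity.BPPRel (Literature.Computability.Complexity.Oracle.ofLanguage K)

/-- Piece 2 of the split (HARDNESS) — verbatim the statement filed for the route decl `BPPNPCannotCountMod`
(local copy until the split lands). -/
def BPPNPCannotCountMod : Prop :=
  ∀ m : ℕ, 2 ≤ m → ¬ ({L : Language Bool | ∃ R ∈ Literature.Computability.Complexity.Classes.P, ∃ p : Polynomial ℕ, ∀ x : List Bool, x ∈ L ↔ ¬ (m ∣ Literature.Computability.Complexity.countWitnesses R (p.eval x.length) x)} ⊆ Literature.Computability.Complexity.BPPRel (Literature.Computability.Complexity.Oracle.ofLanguage Literature.Computability.Complexity.SAT))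


/-! ## Registered stub statements (named `Prop`s: the skeleton audit admits hypotheses BY NAME) -/

namespace Registered

/-- Statement of `stub_publicCoinExtraction` (S1 — public-coin universal extraction (the OPEN heart of PMC).). -/
def stub_publicCoinExtraction : Prop :=
  ∀ (V : IPVerifier) (c : ℕ), V.IsPolyTime → IsPublicCoin V → Sound V c → ∀ M : List Bool → List Bool, Complete V c M → ∃ m : ℕ, 2 ≤ m ∧ ModClass m ⊆ BPPRel M

/-- Statement of `stub_goldwasserSipserEfficient` (S2 — prover-efficient Goldwasser–Sipser (known techniques, XL formal debt).). -/
def stub_goldwasserSipserEfficient : Prop :=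
  ∀ (V : IPVerifier) (c : ℕ), V.IsPolyTime → Sound V c → ∃ (V' : IPVerifier) (c' : ℕ), V'.IsPolyTime ∧ IsPublicCoin V' ∧ Sound V' c' ∧ ∀ M : List Bool → List Bool, Complete V c M → ∃ M' : List Bool → List Bool, Complete V' c' M' ∧ BPPRel M' ⊆ BPPRel M

/-- Statement of `stub_composeFPRel` (S3 — oracle composition (known, L formal debt).). -/
def stub_composeFPRel : Prop :=
  ∀ (O f : Oracle), f ∈ FPRel O → PRel f ⊆ PRel O

/-- Statement of `stub_bppNP_subset_PH` (T1 — `BPP^NP ⊆ PH` (known, L formal debt).). -/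
def stub_bppNP_subset_PH : Prop :=
  BPPRel (Oracle.ofLanguage SAT) ⊆ PH

/-- Statement of `stub_modClass_not_subset_PH` (T2 — no modular counting inside the polynomial hierarchy (OPEN hardness hypothesis).). -/
def stub_modClass_not_subset_PH : Prop :=
  ∀ m : ℕ, 2 ≤ m → ¬ (ModClass m ⊆ PH)

end Registered

/-! ## Stubs for ProversMustCount -/

/-- **S1 — public-coin universal extraction (the OPEN heart of PMC).** For a polynomial-time PUBLIC-COIN verifier
that is sound for `UNSAT` against all provers, EVERY complete prover `M` (an arbitrary function, used as an
oracle: it can be re-run on chosen instances and chosen coin blocks) lets `BPP^M` decide all of `Mod_mP` for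
some `m ≥ 2` depending on `M` (char-`p` sumcheck provers give `m = p`; a verifier accepting the OR of a char-2
and a char-3 sumcheck shows `m` must depend on `M`). Evidence: every known protocol (LFKN/Shamir, GF(p^k)
sumcheck + Valiant–Vazirani, Meir's code sumcheck); the tree's `SumcheckRigidity` + `HonestFirstMessageCounts`
are the deterministic core of the LFKN instance. Why it might fail: a sound verifier whose accepting
transcripts carry no efficiently self-correctable counting information. -/
theorem stub_publicCoinExtraction : Registered.stub_publicCoinExtraction := by
  sorry

/-- **S2 — prover-efficient Goldwasser–Sipser (known techniques, XL formal debt).** Every polynomial-time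
verifier sound for `UNSAT` has a PUBLIC-COIN polynomial-time verifier sound for `UNSAT` such that every complete
prover `M` of the former yields a complete prover `M'` of the latter with `BPP^{M'} ⊆ BPP^{M}`: `M'` is the
Goldwasser–Sipser Merlin (set-size lower-bound protocol, STOC 1986 §4) computed DETERMINISTICALLY from the
transcript, reading its randomness off Arthur's coin blocks, with oracle `M` for the old prover's answers and an
NP oracle for approximate counting / consistent-coin sampling (Stockmeyer 1983; Jerrum–Valiant–Vazirani 1986),
and `SAT ∈ BPP^M` because `(V, M)` is a complete-and-sound protocol for `UNSAT` (simulate it). -/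
theorem stub_goldwasserSipserEfficient : Registered.stub_goldwasserSipserEfficient := by
  sorry

/-- **S3 — oracle composition (known, L formal debt).** `P^{f} ⊆ P^{O}` for `f ∈ FP^{O}` (answer each query to `f`
by running its `FP^O` transducer, forwarding the `O`-queries). VERBATIM the tree's named fact
`Literature.Computability.QuantumComplexity.PRel_subset_PRel_of_mem_FPRel` (BosonSamplingHardness.lean; Arora–Barak
2009 §3.4 Ex. 3.6(2), Rem. 3.8); `BPP^{M} ⊆ BPP^{K}` for `M ∈ FP^K` follows by `bp_mono` (proved, used below).
[Baker–Gill–Solovay 1975 §1; Ladner–Lynch–Selman 1975 §2] -/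
theorem stub_composeFPRel : Registered.stub_composeFPRel := by
  sorry

/-! ## Stubs for BPPNPCannotCountMod -/

/-- **T1 — `BPP^NP ⊆ PH` (known, L formal debt).** Lautemann / Sipser–Gács relativised to the `SAT` oracle:
`BPP^{SAT} ⊆ Σ₂^{p,SAT} = Σ₃ᵖ ⊆ PH`. [Lautemann 1983; Sipser 1983; Arora–Barak 2009, Thm 7.15 with §5.5] -/
theorem stub_bppNP_subset_PH : Registered.stub_bppNP_subset_PH := by
  sorry

/-- **T2 — no modular counting inside the polynomial hierarchy (OPEN hardness hypothesis).** `Mod_mP ⊄ PH` for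
every `m ≥ 2`. Relativised it is TRUE and is exactly Razborov–Smolensky / Håstad (`MOD_m ∉ AC⁰`, via
Furst–Saxe–Sipser); it follows from "PH is infinite" by Toda–Ogiwara (`PH ⊆ BP·Mod_pP`, so `Mod_pP ⊆ Σₖ`
collapses PH); it is NOT known to imply `P ≠ NP` (`P = NP ∧ Mod_mP ≠ P` contradicts nothing known).
[Toda–Ogiwara 1992; Razborov 1987; Smolensky 1987; Furst–Saxe–Sipser 1984] -/
theorem stub_modClass_not_subset_PH : Registered.stub_modClass_not_subset_PH := by
  sorry

/-! ## The two pieces, proved from their stubs, and the composition to the crux -/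

/-- PMC from S1–S3. -/
theorem proversMustCount_of
    (s1 : Registered.stub_publicCoinExtraction) (s2 : Registered.stub_goldwasserSipserEfficient)
    (s3 : Registered.stub_composeFPRel) :
    ProversMustCount := by
  intro V c M K hV hM hC hS
  obtain ⟨V', c', hV', hpc, hS', h⟩ := s2 V c hV hS
  obtain ⟨M', hC', hincl⟩ := h M hC
  obtain ⟨m, hm, hsub⟩ := s1 V' c' hV' hpc hS' M' hC'
  exact ⟨m, hm, hsub.trans (hincl.trans (bp_mono (s3 _ M hM)))⟩

/-- NMC from T1–T2. -/
theorem bppNPCannotCountMod_of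
    (t1 : Registered.stub_bppNP_subset_PH) (t2 : Registered.stub_modClass_not_subset_PH) :
    BPPNPCannotCountMod := by
  intro m hm hsub
  exact t2 m hm (hsub.trans t1)

/-- **Composition**: the five stubs give the crux `Thesis` BY NAME (through the two pieces and the split's
assembly, modus ponens at `K := SAT`). -/
theorem Thesis_of
    (s1 : Registered.stub_publicCoinExtraction) (s2 : Registered.stub_goldwasserSipserEfficient)
    (s3 : Registered.stub_composeFPRel) (t1 : Registered.stub_bppNP_subset_PH)
    (t2 : Registered.stub_modClass_not_subset_PH) :
    Summit.PneNP.PneNP.Theses.UncheckableSAT.Thesis := by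
  have hPMC : ProversMustCount := proversMustCount_of s1 s2 s3
  have hNMC : BPPNPCannotCountMod := bppNPCannotCountMod_of t1 t2
  rintro ⟨V, c, M, hV, hM, hC, hS⟩
  obtain ⟨m, hm, hsub⟩ := hPMC V c M SAT hV hM hC hS
  exact hNMC m hm hsub

end Summit.PneNP.PneNP.Cruxes.Thesis.CountingSplit
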